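import Literature.Barriers.CriticalPhenomena.TreesPercolatingAtCriticalityWedgeSubcritical
import HarnessLib

/-!
# Transplant sharpness V — the gridded log-wedge is rough-isometric to `ℤ²`: explicit walks

builds on p205010 (kernel theorem, internal audit signed; external expert review pending).
Status sentence (coordinator 2026-08-20T04:30Z): "θ(p_c) = 0 on ℤ^d, all d ≥ 2 — kernel-verified (Lean 4/Mathlib,
standard axioms); internal adversarial audit SIGNED 2026-08-20 04:29Z; external expert review pending."

Lane `prim-bschramm`, seat p5 (sharpness); memo `run/shared/lean/prim/bschramm/P5-SHARPNESS.md` §40 (row 83),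
`run/shared/lean/prim/bschramm/prim-bschramm-p5-g19/GRIDWEDGE-PROOF.md` §2.  Companion of
`Transplant/SharpnessGridWedge.lean` (the percolation half).  Everything here is PROVED and elementary: for a vertex set
`S ⊆ ℤ²` that contains Grimmett's wedge `W = logWedge a b` (`a, b ≥ 0`) and the grid lines of mesh `M ≥ 1`
(`M ∣ x₀ ∨ M ∣ x₁`), and consists of nothing else, any two vertices `x, y` of the induced subgraph `ℤ²[S]` are joined
INSIDE `ℤ²[S]` by a walk of length `≤ ‖x - y‖₁ + 4M` (`exists_walk_length_le_of_wedge_grid`), while every walk of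
`ℤ²[S]` (indeed of `ℤ²`) from `x` to `y` has length `≥ ‖x - y‖₁` (`l1_le_length_induce`).  With the density of the
grid (`gridLines_dense` in the companion file: every lattice point is within `⌊M/2⌋` of `S`) this says that the
inclusion `S ↪ ℤ²` is a rough isometry (quasi-isometry) with multiplicative constant `1` and additive constant `4M`
(Lyons–Peres 2016 §2.6) — the geometric half of P5-SHARPNESS row 83 ("a planar, degree-`≤ 4` graph rough-isometric
to `ℤ²` …").  Routing: inside `W` along a row then a column (rows of `W` extend to the right and columns of `W` are
intervals because the profile is non-decreasing); on the grid along at most three grid lines; from `W` to the grid by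
`≤ M - 1` steps to the right.

References: G. Grimmett, *Percolation*, 2nd ed. (1999), §11.5 (11.50); R. Lyons, Y. Peres, *Probability on Trees and
Networks* (2016), §2.6 (rough isometries).
-/

namespace Summit.CriticalPhenomena.PercolationContinuityZ3.Theorems.TransplantSharpness

open Literature.Probability.LatticeModels Literature.Barriers.CriticalPhenomena
open Literature.Barriers.CriticalPhenomena.LogWedge (profile mem_logWedge_iff_profile profile_mono)

/-! ## `ℓ¹` controls walk length from below in `ℤ²` -/

/-- A lattice step changes `|Δx₀| + |Δx₁|` by exactly one. [folklore] -/
theorem l1_step {u v : Site 2} (h : (zdGraph 2).Adj u v) :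
    |v 0 - u 0| + |v 1 - u 1| = 1 := by
  obtain ⟨j, hj | hj⟩ := (zdGraph_adj_iff u v).1 h
  · rw [hj]; fin_cases j <;> simp
  · rw [hj]; fin_cases j <;> simp

/-- **`‖y - x‖₁ ≤` length** for every nearest-neighbour walk of `ℤ²`. [folklore] -/
theorem l1_le_length {u v : Site 2} (w : (zdGraph 2).Walk u v) :
    |v 0 - u 0| + |v 1 - u 1| ≤ w.length := by
  induction w with
  | nil => simp
  | @cons a c e hac p ih =>
    rw [SimpleGraph.Walk.length_cons, Nat.cast_add, Nat.cast_one]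
    have hs := l1_step hac
    calc |e 0 - a 0| + |e 1 - a 1|
        = |(e 0 - c 0) + (c 0 - a 0)| + |(e 1 - c 1) + (c 1 - a 1)| := by ring_nf
      _ ≤ (|e 0 - c 0| + |c 0 - a 0|) + (|e 1 - c 1| + |c 1 - a 1|) := add_le_add (abs_add_le _ _) (abs_add_le _ _)
      _ = (|e 0 - c 0| + |e 1 - c 1|) + (|c 0 - a 0| + |c 1 - a 1|) := by ring
      _ ≤ p.length + 1 := add_le_add ih hs.le

/-- **Lower bound in an induced subgraph**: a walk of `ℤ²[S]` from `x` to `y` has length `≥ ‖y - x‖₁`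
(map it into `ℤ²`). [folklore] -/
theorem l1_le_length_induce {S : Set (Site 2)} {x y : S} (w : ((zdGraph 2).induce S).Walk x y) :
    |(y : Site 2) 0 - (x : Site 2) 0| + |(y : Site 2) 1 - (x : Site 2) 1| ≤ w.length := by
  have h := l1_le_length (w.map (SimpleGraph.Embedding.induce S).toHom)
  rwa [SimpleGraph.Walk.length_map] at h

/-! ## Straight walks inside an induced subgraph of `ℤ²` -/

section Straight

variable {S : Set (Site 2)}

/-- **Walk to the right** inside `ℤ²[S]`: if `(i + k, j) ∈ S` for `0 ≤ k ≤ n` then `(i, j)` and `(i + n, j)` are joined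
in `ℤ²[S]` by a walk of length `n`. [folklore] -/
theorem exists_walk_right (i j : ℤ) :
    ∀ (n : ℕ) (h : ∀ k : ℕ, k ≤ n → (![i + k, j] : Site 2) ∈ S)
      (hx : (![i, j] : Site 2) ∈ S) (hy : (![i + n, j] : Site 2) ∈ S),
      ∃ w : ((zdGraph 2).induce S).Walk ⟨![i, j], hx⟩ ⟨![i + n, j], hy⟩, w.length = n
  | 0, _, hx, hy => ⟨SimpleGraph.Walk.nil.copy rfl (by simp), by simp⟩
  | n + 1, h, hx, hy => by
    have hmid : (![i + n, j] : Site 2) ∈ S := h n (Nat.le_succ n)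
    obtain ⟨w, hw⟩ := exists_walk_right i j n (fun k hk => h k (hk.trans (Nat.le_succ n))) hx hmid
    have hadj : ((zdGraph 2).induce S).Adj ⟨![i + n, j], hmid⟩ ⟨![i + (n + 1 : ℕ), j], hy⟩ := by
      rw [SimpleGraph.induce_adj]
      show (zdGraph 2).Adj (![i + n, j] : Site 2) ![i + ((n + 1 : ℕ) : ℤ), j]
      have : (![i + ((n + 1 : ℕ) : ℤ), j] : Site 2) = ![i + n + 1, j] := by push_cast; rw [add_assoc]
      rw [this, logWedge_vec_succ_left]; exact zdGraph_adj_add_unit _ 0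
    exact ⟨w.concat hadj, by rw [SimpleGraph.Walk.length_concat, hw]⟩

/-- **Walk upwards** inside `ℤ²[S]`: if `(i, j + k) ∈ S` for `0 ≤ k ≤ n` then `(i, j)` and `(i, j + n)` are joined in
`ℤ²[S]` by a walk of length `n`. [folklore] -/
theorem exists_walk_up (i j : ℤ) :
    ∀ (n : ℕ) (h : ∀ k : ℕ, k ≤ n → (![i, j + k] : Site 2) ∈ S)
      (hx : (![i, j] : Site 2) ∈ S) (hy : (![i, j + n] : Site 2) ∈ S),
      ∃ w : ((zdGraph 2).induce S).Walk ⟨![i, j], hx⟩ ⟨![i, j + n], hy⟩, w.length = n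
  | 0, _, hx, hy => ⟨SimpleGraph.Walk.nil.copy rfl (by simp), by simp⟩
  | n + 1, h, hx, hy => by
    have hmid : (![i, j + n] : Site 2) ∈ S := h n (Nat.le_succ n)
    obtain ⟨w, hw⟩ := exists_walk_up i j n (fun k hk => h k (hk.trans (Nat.le_succ n))) hx hmid
    have hadj : ((zdGraph 2).induce S).Adj ⟨![i, j + n], hmid⟩ ⟨![i, j + (n + 1 : ℕ)], hy⟩ := by
      rw [SimpleGraph.induce_adj]
      show (zdGraph 2).Adj (![i, j + n] : Site 2) ![i, j + ((n + 1 : ℕ) : ℤ)]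
      have : (![i, j + ((n + 1 : ℕ) : ℤ)] : Site 2) = ![i, j + n + 1] := by push_cast; rw [add_assoc]
      rw [this, logWedge_vec_succ_right]; exact zdGraph_adj_add_unit _ 1
    exact ⟨w.concat hadj, by rw [SimpleGraph.Walk.length_concat, hw]⟩

/-- **Horizontal walk between `(i, j)` and `(i', j)`** (either order) when the whole row segment lies in `S`:
length `|i' - i|`. [folklore] -/
theorem exists_walk_row {i i' j : ℤ} (h : ∀ t : ℤ, min i i' ≤ t → t ≤ max i i' → (![t, j] : Site 2) ∈ S)
    (hx : (![i, j] : Site 2) ∈ S) (hy : (![i', j] : Site 2) ∈ S) :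
    ∃ w : ((zdGraph 2).induce S).Walk ⟨![i, j], hx⟩ ⟨![i', j], hy⟩, (w.length : ℤ) = |i' - i| := by
  rcases le_total i i' with hle | hle
  · obtain ⟨n, hn⟩ := Int.eq_ofNat_of_zero_le (sub_nonneg.2 hle)
    have hi' : i' = i + n := by omega
    subst hi'
    obtain ⟨w, hw⟩ := exists_walk_right (S := S) i j n
      (fun k hk => h _ (by rw [min_eq_left hle]; omega) (by rw [max_eq_right hle]; omega)) hx hy
    exact ⟨w, by rw [hw, add_sub_cancel_left, abs_of_nonneg (by omega)]⟩
  · obtain ⟨n, hn⟩ := Int.eq_ofNat_of_zero_le (sub_nonneg.2 hle)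
    have hi : i = i' + n := by omega
    subst hi
    obtain ⟨w, hw⟩ := exists_walk_right (S := S) i' j n
      (fun k hk => h _ (by rw [min_eq_right hle]; omega) (by rw [max_eq_left hle]; omega)) hy hx
    exact ⟨w.reverse, by rw [SimpleGraph.Walk.length_reverse, hw]; rw [abs_of_nonpos (by omega)]; ring⟩

/-- **Vertical walk between `(i, j)` and `(i, j')`** (either order) when the whole column segment lies in `S`:
length `|j' - j|`. [folklore] -/
theorem exists_walk_col {i j j' : ℤ} (h : ∀ t : ℤ, min j j' ≤ t → t ≤ max j j' → (![i, t] : Site 2) ∈ S)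
    (hx : (![i, j] : Site 2) ∈ S) (hy : (![i, j'] : Site 2) ∈ S) :
    ∃ w : ((zdGraph 2).induce S).Walk ⟨![i, j], hx⟩ ⟨![i, j'], hy⟩, (w.length : ℤ) = |j' - j| := by
  rcases le_total j j' with hle | hle
  · obtain ⟨n, hn⟩ := Int.eq_ofNat_of_zero_le (sub_nonneg.2 hle)
    have hj' : j' = j + n := by omega
    subst hj'
    obtain ⟨w, hw⟩ := exists_walk_up (S := S) i j n
      (fun k hk => h _ (by rw [min_eq_left hle]; omega) (by rw [max_eq_right hle]; omega)) hx hy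
    exact ⟨w, by rw [hw, add_sub_cancel_left, abs_of_nonneg (by omega)]⟩
  · obtain ⟨n, hn⟩ := Int.eq_ofNat_of_zero_le (sub_nonneg.2 hle)
    have hj : j = j' + n := by omega
    subst hj
    obtain ⟨w, hw⟩ := exists_walk_up (S := S) i j' n
      (fun k hk => h _ (by rw [min_eq_right hle]; omega) (by rw [max_eq_left hle]; omega)) hy hx
    exact ⟨w.reverse, by rw [SimpleGraph.Walk.length_reverse, hw]; rw [abs_of_nonpos (by omega)]; ring⟩

end Straight

/-! ## Inside the wedge: rows extend to the right, columns are intervals -/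

section Wedge

variable {a b : ℝ}

/-- Rows of the wedge extend to the right: `(i, j) ∈ W`, `i ≤ t` ⟹ `(t, j) ∈ W` (the profile is non-decreasing,
`profile_mono`). [folklore] -/
theorem row_right_mem_logWedge (ha : 0 ≤ a) (hb : 0 ≤ b) {i j t : ℤ} (h : (![i, j] : Site 2) ∈ logWedge a b)
    (ht : i ≤ t) : (![t, j] : Site 2) ∈ logWedge a b := by
  rw [vec_mem_logWedge_iff] at h ⊢
  obtain ⟨hi, hj, hle⟩ := h
  refine ⟨hi.trans ht, hj, hle.trans ?_⟩
  have hmono := profile_mono ha hb (u := (i : ℝ)) (u' := (t : ℝ)) (by exact_mod_cast hi) (by exact_mod_cast ht)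
  simpa only [profile] using hmono

/-- Columns of the wedge are intervals: the segment between two wedge points of the same column lies in the wedge
(`col_mem_logWedge`). [folklore] -/
theorem col_segment_mem_logWedge {i j j' t : ℤ} (h1 : (![i, j] : Site 2) ∈ logWedge a b)
    (h2 : (![i, j'] : Site 2) ∈ logWedge a b) (ht1 : min j j' ≤ t) (ht2 : t ≤ max j j') :
    (![i, t] : Site 2) ∈ logWedge a b := by
  have hj : 0 ≤ j := ((vec_mem_logWedge_iff a b i j).1 h1).2.1
  have hj' : 0 ≤ j' := ((vec_mem_logWedge_iff a b i j').1 h2).2.1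
  rcases le_total j j' with h | h
  · rw [max_eq_right h] at ht2; rw [min_eq_left h] at ht1
    exact col_mem_logWedge h2 (hj.trans ht1) ht2
  · rw [max_eq_left h] at ht2; rw [min_eq_right h] at ht1
    exact col_mem_logWedge h1 (hj'.trans ht1) ht2

/-- **Two wedge points are joined inside `ℤ²[S]` (any `S ⊇ W`) by a walk of length `≤ ‖y - x‖₁`** (row to the right,
then column; GRIDWEDGE-PROOF.md §2: `d_{G′} = d_{ℤ²}` on `W`). [folklore] -/
theorem exists_walk_of_mem_logWedge (ha : 0 ≤ a) (hb : 0 ≤ b) {S : Set (Site 2)} (hWS : logWedge a b ⊆ S)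
    {i j i' j' : ℤ} (hx : (![i, j] : Site 2) ∈ logWedge a b) (hy : (![i', j'] : Site 2) ∈ logWedge a b) :
    ∃ w : ((zdGraph 2).induce S).Walk ⟨![i, j], hWS hx⟩ ⟨![i', j'], hWS hy⟩,
      (w.length : ℤ) ≤ |i' - i| + |j' - j| := by
  -- the construction for `i ≤ i'`, packaged so that it can be used in both orders
  have key : ∀ {i j i' j' : ℤ} (hx : (![i, j] : Site 2) ∈ logWedge a b) (hy : (![i', j'] : Site 2) ∈ logWedge a b),
      i ≤ i' → ∃ w : ((zdGraph 2).induce S).Walk ⟨![i, j], hWS hx⟩ ⟨![i', j'], hWS hy⟩,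
        (w.length : ℤ) ≤ |i' - i| + |j' - j| := by
    intro i j i' j' hx hy hii
    have hmid : (![i', j] : Site 2) ∈ logWedge a b := row_right_mem_logWedge ha hb hx hii
    obtain ⟨w₁, hw₁⟩ := exists_walk_row (S := S) (i := i) (i' := i') (j := j)
      (fun t ht1 _ => hWS (row_right_mem_logWedge ha hb hx (by rw [min_eq_left hii] at ht1; exact ht1)))
      (hWS hx) (hWS hmid)
    obtain ⟨w₂, hw₂⟩ := exists_walk_col (S := S) (i := i') (j := j) (j' := j')
      (fun t ht1 ht2 => hWS (col_segment_mem_logWedge hmid hy ht1 ht2)) (hWS hmid) (hWS hy)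
    exact ⟨w₁.append w₂, by rw [SimpleGraph.Walk.length_append, Nat.cast_add, hw₁, hw₂]⟩
  rcases le_total i i' with hii | hii
  · exact key hx hy hii
  · obtain ⟨w, hw⟩ := key hy hx hii
    exact ⟨w.reverse, by rw [SimpleGraph.Walk.length_reverse, abs_sub_comm i' i, abs_sub_comm j' j]; exact hw⟩

end Wedge

/-! ## On the grid lines of mesh `M` -/

section Grid

variable {S : Set (Site 2)} {M : ℕ}

/-- A point of a vertical grid line belongs to `S` (under the standing hypothesis `hL`). [folklore] -/
theorem mem_of_dvd_fst (hL : ∀ z : Site 2, ((M : ℤ) ∣ z 0 ∨ (M : ℤ) ∣ z 1) → z ∈ S) {i : ℤ}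
    (hi : (M : ℤ) ∣ i) (t : ℤ) : (![i, t] : Site 2) ∈ S :=
  hL _ (Or.inl (by simpa using hi))

/-- A point of a horizontal grid line belongs to `S` (under the standing hypothesis `hL`). [folklore] -/
theorem mem_of_dvd_snd (hL : ∀ z : Site 2, ((M : ℤ) ∣ z 0 ∨ (M : ℤ) ∣ z 1) → z ∈ S) {j : ℤ}
    (hj : (M : ℤ) ∣ j) (t : ℤ) : (![t, j] : Site 2) ∈ S :=
  hL _ (Or.inr (by simpa using hj))

/-- The multiple of `M` just below `j`: `M ∣ M (j / M)` and `0 ≤ j - M (j / M) ≤ M - 1` (for `M ≥ 1`). [folklore] -/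
theorem floorMul_bounds (hM : 1 ≤ M) (j : ℤ) :
    (M : ℤ) ∣ (M : ℤ) * (j / M) ∧ 0 ≤ j - (M : ℤ) * (j / M) ∧ j - (M : ℤ) * (j / M) ≤ (M : ℤ) - 1 := by
  have hMpos : (0 : ℤ) < (M : ℤ) := by exact_mod_cast hM
  have hdec : (M : ℤ) * (j / M) + j % M = j := Int.mul_ediv_add_emod _ _
  have h0 : 0 ≤ j % (M : ℤ) := Int.emod_nonneg _ hMpos.ne'
  have h1 : j % (M : ℤ) < M := Int.emod_lt_of_pos _ hMpos
  exact ⟨dvd_mul_right _ _, by omega, by omega⟩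

/-- **Two grid points are joined inside `ℤ²[S]` by a walk of length `≤ ‖y - x‖₁ + 2M`** (along at most three grid
lines; GRIDWEDGE-PROOF.md §2). [folklore] -/
theorem exists_walk_of_grid (hM : 1 ≤ M) (hL : ∀ z : Site 2, ((M : ℤ) ∣ z 0 ∨ (M : ℤ) ∣ z 1) → z ∈ S)
    {i j i' j' : ℤ} (hxg : (M : ℤ) ∣ i ∨ (M : ℤ) ∣ j) (hyg : (M : ℤ) ∣ i' ∨ (M : ℤ) ∣ j')
    (hx : (![i, j] : Site 2) ∈ S) (hy : (![i', j'] : Site 2) ∈ S) :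
    ∃ w : ((zdGraph 2).induce S).Walk ⟨![i, j], hx⟩ ⟨![i', j'], hy⟩,
      (w.length : ℤ) ≤ |i' - i| + |j' - j| + 2 * M := by
  have hM0 : (0 : ℤ) ≤ (M : ℤ) := by exact_mod_cast (Nat.zero_le M)
  -- case A: `x` on a vertical line, `y` on a horizontal line: column then row, length `‖y - x‖₁`
  have caseVH : ∀ {i j i' j' : ℤ} (hi : (M : ℤ) ∣ i) (hj' : (M : ℤ) ∣ j')
      (hx : (![i, j] : Site 2) ∈ S) (hy : (![i', j'] : Site 2) ∈ S),
      ∃ w : ((zdGraph 2).induce S).Walk ⟨![i, j], hx⟩ ⟨![i', j'], hy⟩,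
        (w.length : ℤ) ≤ |i' - i| + |j' - j| + 2 * M := by
    intro i j i' j' hi hj' hx hy
    have hc : (![i, j'] : Site 2) ∈ S := mem_of_dvd_fst hL hi j'
    obtain ⟨w₁, hw₁⟩ := exists_walk_col (S := S) (fun t _ _ => mem_of_dvd_fst hL hi t) hx hc
    obtain ⟨w₂, hw₂⟩ := exists_walk_row (S := S) (fun t _ _ => mem_of_dvd_snd hL hj' t) hc hy
    refine ⟨w₁.append w₂, ?_⟩
    rw [SimpleGraph.Walk.length_append, Nat.cast_add, hw₁, hw₂]
    linarith [abs_nonneg (i' - i), abs_nonneg (j' - j)]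
  -- case B: both on vertical lines: down/up to the horizontal line `h = M (j / M)`, across, and back
  have caseVV : ∀ {i j i' j' : ℤ} (hi : (M : ℤ) ∣ i) (hi' : (M : ℤ) ∣ i')
      (hx : (![i, j] : Site 2) ∈ S) (hy : (![i', j'] : Site 2) ∈ S),
      ∃ w : ((zdGraph 2).induce S).Walk ⟨![i, j], hx⟩ ⟨![i', j'], hy⟩,
        (w.length : ℤ) ≤ |i' - i| + |j' - j| + 2 * M := by
    intro i j i' j' hi hi' hx hy
    obtain ⟨hh, hlo, hhi⟩ := floorMul_bounds hM j
    set h : ℤ := (M : ℤ) * (j / M) with hdef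
    have hc₁ : (![i, h] : Site 2) ∈ S := mem_of_dvd_fst hL hi h
    have hc₂ : (![i', h] : Site 2) ∈ S := mem_of_dvd_fst hL hi' h
    obtain ⟨w₁, hw₁⟩ := exists_walk_col (S := S) (fun t _ _ => mem_of_dvd_fst hL hi t) hx hc₁
    obtain ⟨w₂, hw₂⟩ := exists_walk_row (S := S) (fun t _ _ => mem_of_dvd_snd hL hh t) hc₁ hc₂
    obtain ⟨w₃, hw₃⟩ := exists_walk_col (S := S) (fun t _ _ => mem_of_dvd_fst hL hi' t) hc₂ hy
    refine ⟨(w₁.append w₂).append w₃, ?_⟩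
    rw [SimpleGraph.Walk.length_append, SimpleGraph.Walk.length_append, Nat.cast_add, Nat.cast_add, hw₁, hw₂, hw₃]
    have e1 : |h - j| ≤ (M : ℤ) - 1 := by rw [abs_sub_comm]; rw [abs_of_nonneg hlo]; exact hhi
    have e2 : |j' - h| ≤ |j' - j| + |j - h| := by
      calc |j' - h| = |(j' - j) + (j - h)| := by ring_nf
        _ ≤ |j' - j| + |j - h| := abs_add_le _ _
    have e3 : |j - h| ≤ (M : ℤ) - 1 := by rw [abs_of_nonneg hlo]; exact hhi
    linarith
  -- case C: both on horizontal lines: across to the vertical line `v = M (i / M)`, up/down, and across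
  have caseHH : ∀ {i j i' j' : ℤ} (hj : (M : ℤ) ∣ j) (hj' : (M : ℤ) ∣ j')
      (hx : (![i, j] : Site 2) ∈ S) (hy : (![i', j'] : Site 2) ∈ S),
      ∃ w : ((zdGraph 2).induce S).Walk ⟨![i, j], hx⟩ ⟨![i', j'], hy⟩,
        (w.length : ℤ) ≤ |i' - i| + |j' - j| + 2 * M := by
    intro i j i' j' hj hj' hx hy
    obtain ⟨hv, hlo, hhi⟩ := floorMul_bounds hM i
    set v : ℤ := (M : ℤ) * (i / M) with hdef
    have hc₁ : (![v, j] : Site 2) ∈ S := mem_of_dvd_snd hL hj v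
    have hc₂ : (![v, j'] : Site 2) ∈ S := mem_of_dvd_snd hL hj' v
    obtain ⟨w₁, hw₁⟩ := exists_walk_row (S := S) (fun t _ _ => mem_of_dvd_snd hL hj t) hx hc₁
    obtain ⟨w₂, hw₂⟩ := exists_walk_col (S := S) (fun t _ _ => mem_of_dvd_fst hL hv t) hc₁ hc₂
    obtain ⟨w₃, hw₃⟩ := exists_walk_row (S := S) (fun t _ _ => mem_of_dvd_snd hL hj' t) hc₂ hy
    refine ⟨(w₁.append w₂).append w₃, ?_⟩
    rw [SimpleGraph.Walk.length_append, SimpleGraph.Walk.length_append, Nat.cast_add, Nat.cast_add, hw₁, hw₂, hw₃]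
    have e1 : |v - i| ≤ (M : ℤ) - 1 := by rw [abs_sub_comm]; rw [abs_of_nonneg hlo]; exact hhi
    have e2 : |i' - v| ≤ |i' - i| + |i - v| := by
      calc |i' - v| = |(i' - i) + (i - v)| := by ring_nf
        _ ≤ |i' - i| + |i - v| := abs_add_le _ _
    have e3 : |i - v| ≤ (M : ℤ) - 1 := by rw [abs_of_nonneg hlo]; exact hhi
    linarith
  rcases hxg with hi | hj
  · rcases hyg with hi' | hj'
    · exact caseVV hi hi' hx hy
    · exact caseVH hi hj' hx hy
  · rcases hyg with hi' | hj'
    · -- `x` horizontal, `y` vertical: reverse of case A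
      obtain ⟨w, hw⟩ := caseVH hi' hj hy hx
      exact ⟨w.reverse, by
        rw [SimpleGraph.Walk.length_reverse, abs_sub_comm i' i, abs_sub_comm j' j]; exact hw⟩
    · exact caseHH hj hj' hx hy

end Grid

/-! ## From the wedge to the grid, and the general bound -/

section WedgeGrid

variable {a b : ℝ} {S : Set (Site 2)} {M : ℕ}

/-- The multiple of `M` just above `i`: `u = M (i / M) + M` satisfies `M ∣ u` and `i ≤ u ≤ i + M` (`M ≥ 1`). [folklore] -/
theorem ceilMul_bounds (hM : 1 ≤ M) (i : ℤ) :
    (M : ℤ) ∣ (M : ℤ) * (i / M) + M ∧ i ≤ (M : ℤ) * (i / M) + M ∧ (M : ℤ) * (i / M) + M ≤ i + M := by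
  obtain ⟨hd, hlo, hhi⟩ := floorMul_bounds hM i
  exact ⟨dvd_add hd (dvd_refl _), by omega, by omega⟩

/-- **A wedge point and a grid point are joined inside `ℤ²[S]` by a walk of length `≤ ‖y - x‖₁ + 4M`**: go right
inside the wedge to the next vertical grid line (`≤ M` steps), then along the grid (GRIDWEDGE-PROOF.md §2). [folklore] -/
theorem exists_walk_wedge_to_grid (ha : 0 ≤ a) (hb : 0 ≤ b) (hM : 1 ≤ M) (hWS : logWedge a b ⊆ S)
    (hL : ∀ z : Site 2, ((M : ℤ) ∣ z 0 ∨ (M : ℤ) ∣ z 1) → z ∈ S)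
    {i j i' j' : ℤ} (hx : (![i, j] : Site 2) ∈ logWedge a b) (hyg : (M : ℤ) ∣ i' ∨ (M : ℤ) ∣ j')
    (hy : (![i', j'] : Site 2) ∈ S) :
    ∃ w : ((zdGraph 2).induce S).Walk ⟨![i, j], hWS hx⟩ ⟨![i', j'], hy⟩,
      (w.length : ℤ) ≤ |i' - i| + |j' - j| + 4 * M := by
  obtain ⟨hu, hiu, hui⟩ := ceilMul_bounds hM i
  set u : ℤ := (M : ℤ) * (i / M) + M with hudef
  have hmidW : (![u, j] : Site 2) ∈ logWedge a b := row_right_mem_logWedge ha hb hx hiu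
  obtain ⟨w₁, hw₁⟩ := exists_walk_row (S := S) (i := i) (i' := u) (j := j)
    (fun t ht1 _ => hWS (row_right_mem_logWedge ha hb hx (by rw [min_eq_left hiu] at ht1; exact ht1)))
    (hWS hx) (hWS hmidW)
  obtain ⟨w₂, hw₂⟩ := exists_walk_of_grid hM hL (Or.inl hu) hyg (hWS hmidW) hy
  refine ⟨w₁.append w₂, ?_⟩
  rw [SimpleGraph.Walk.length_append, Nat.cast_add, hw₁]
  have e1 : |u - i| ≤ (M : ℤ) := by rw [abs_of_nonneg (by omega)]; omega
  have e2 : |i' - u| ≤ |i' - i| + |i - u| := by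
    calc |i' - u| = |(i' - i) + (i - u)| := by ring_nf
      _ ≤ |i' - i| + |i - u| := abs_add_le _ _
  have e3 : |i - u| ≤ (M : ℤ) := by rw [abs_sub_comm]; exact e1
  linarith

/-- **The inclusion `S ↪ ℤ²` is a `(1, 4M)`-rough isometry onto its image (upper bound)**: if `S` contains the wedge
`W = logWedge a b` (`a, b ≥ 0`) and the grid lines of mesh `M ≥ 1`, and every point of `S` lies in `W` or on a grid
line, then any two points of `S` are joined INSIDE `ℤ²[S]` by a walk of length `≤ ‖y - x‖₁ + 4M`.  With
`l1_le_length_induce` (`≥ ‖y - x‖₁`) and the density of the grid this is the statement "the gridded wedge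
`ℤ²[W ∪ L_M]` is rough-isometric to `ℤ²` with multiplicative constant `1`" of P5-SHARPNESS §40 row 83 /
GRIDWEDGE-PROOF.md §2 (there with `3M`; the routing here is slightly lazier). [folklore] -/
theorem exists_walk_length_le_of_wedge_grid (ha : 0 ≤ a) (hb : 0 ≤ b) (hM : 1 ≤ M)
    (hWS : logWedge a b ⊆ S) (hL : ∀ z : Site 2, ((M : ℤ) ∣ z 0 ∨ (M : ℤ) ∣ z 1) → z ∈ S)
    (hS : ∀ z ∈ S, z ∈ logWedge a b ∨ ((M : ℤ) ∣ z 0 ∨ (M : ℤ) ∣ z 1))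
    (x y : Site 2) (hx : x ∈ S) (hy : y ∈ S) :
    ∃ w : ((zdGraph 2).induce S).Walk ⟨x, hx⟩ ⟨y, hy⟩,
      (w.length : ℤ) ≤ |y 0 - x 0| + |y 1 - x 1| + 4 * M := by
  have hM0 : (0 : ℤ) ≤ (M : ℤ) := by exact_mod_cast Nat.zero_le M
  have ex : x = ![x 0, x 1] := by funext k; fin_cases k <;> rfl
  have ey : y = ![y 0, y 1] := by funext k; fin_cases k <;> rfl
  have hx' : (![x 0, x 1] : Site 2) ∈ S := ex ▸ hx
  have hy' : (![y 0, y 1] : Site 2) ∈ S := ey ▸ hy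
  suffices H : ∃ w : ((zdGraph 2).induce S).Walk ⟨![x 0, x 1], hx'⟩ ⟨![y 0, y 1], hy'⟩,
      (w.length : ℤ) ≤ |y 0 - x 0| + |y 1 - x 1| + 4 * M by
    obtain ⟨w, hw⟩ := H
    exact ⟨w.copy (Subtype.ext ex.symm) (Subtype.ext ey.symm), by rw [SimpleGraph.Walk.length_copy]; exact hw⟩
  rcases hS _ hx with hxW | hxG
  · have hxW' : (![x 0, x 1] : Site 2) ∈ logWedge a b := ex ▸ hxW
    rcases hS _ hy with hyW | hyG
    · have hyW' : (![y 0, y 1] : Site 2) ∈ logWedge a b := ey ▸ hyW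
      obtain ⟨w, hw⟩ := exists_walk_of_mem_logWedge ha hb hWS hxW' hyW'
      exact ⟨w, by linarith⟩
    · exact exists_walk_wedge_to_grid ha hb hM hWS hL hxW' hyG hy'
  · rcases hS _ hy with hyW | hyG
    · have hyW' : (![y 0, y 1] : Site 2) ∈ logWedge a b := ey ▸ hyW
      obtain ⟨w, hw⟩ := exists_walk_wedge_to_grid ha hb hM hWS hL hyW' hxG hx'
      exact ⟨w.reverse, by
        rw [SimpleGraph.Walk.length_reverse, abs_sub_comm (y 0) (x 0), abs_sub_comm (y 1) (x 1)]; exact hw⟩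
    · obtain ⟨w, hw⟩ := exists_walk_of_grid hM hL hxG hyG hx' hy'
      exact ⟨w, by linarith⟩

end WedgeGrid

end Summit.CriticalPhenomena.PercolationContinuityZ3.Theorems.TransplantSharpness
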